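import Literature.NumberTheory.GaloisCohomology.LocalInvariantMapPadic
import Literature.AnabelianGeometry.AbsoluteAnabelian.LocalResidueMapRestriction
import Literature.NumberTheory.GaloisRepresentations.ContinuousCohomologyConnectingNaturality
import HarnessLib

/-!
# The `p`-adic Kummer map `κ_∞ : Kˣ → H¹(G_K, ℤ_p(1))` as the limit of the Kummer classes
# `κ_{p^k}(x) ∈ H¹(G_K, μ_{p^k})` (Kato, LNM 1553, Ch. II 1.4.2: "the image of `π` under `Kˣ → H¹(K, ℚ_ℓ(1))`
# induced by the connecting maps of the Kummer sequences")

Topic `NumberTheory/GaloisCohomology`; namespace `Literature.NumberTheory.GaloisCohomology`.  Definitions with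
bodies and theorems only (no named fact, no instance, no `sorry`).  Companion of `LocalInvariantMapPadic.lean`
(`muPadicSystem`, `tateModuleMuPadic K p = ℤ_p(1)(K̄) = lim_k μ_{p^k}(K̄)`,
`continuousCohomologyOnePadicTateModuleEquiv : H¹_cont(G_K, ℤ_p(1)) ≃+ lim_k H¹(G_K, μ_{p^k})`).

For a field `K`, `n ≥ 1` and `x ∈ Kˣ`, the Kummer class `κ_n(x) = δ₀(x) ∈ H¹(G_K, μ_n(K̄))` is the image of the
invariant `x ∈ (K̄ˣ)^{G_K}` under the connecting map of the Kummer sequence `0 → μ_n → K̄ˣ →(n) K̄ˣ → 0` (tree: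
`isSES_kummer`, `IsSES.δ₀`, `baseUnitsInvariant`).  We prove:

* `kummerLevel K n hn x hx` = `κ_n(x)`; `kummerLevel_mul` (`κ_n(xy) = κ_n(x) + κ_n(y)`);
* `cohomologyMap_muPowHom_kummerLevel` — **compatibility with the power maps**: `H¹(μ_N ↠ μ_n)(κ_N(x)) = κ_n(x)` for
  `n · d = N` (naturality of `δ₀`, tree `IsSES.cohomologyMap_δ₀`, for the morphism `(ζ ↦ ζ^d, u ↦ u^d, id)` of Kummer
  sequences);
* `kummerFamily K p x hx ∈ lim_k H¹(G_K, μ_{p^k})` — the compatible family `(κ_{p^k}(x))_k`;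
* ★ `kummerPadic K p x hx ∈ H¹_cont(G_K, ℤ_p(1))` — **the `p`-adic Kummer class `κ_∞(x)`** (any field `K`), with its
  LEVEL FORMULA `cohomologyMap_projHom_kummerPadic : H¹(ℤ_p(1) ↠ μ_{p^k})(κ_∞(x)) = κ_{p^k}(x)`, uniqueness from the levels
  (`eq_kummerPadic_of_proj`), multiplicativity (`kummerPadic_mul`) and the homomorphism
  `kummerPadicHom K p : Kˣ →* Multiplicative H¹_cont(G_K, ℤ_p(1))`.

This is the `H¹`-side partner of the `p`-adic invariant map `invPadic` (floor K3-c of the K3 programme of the line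
`kato_lever` on crux K★ `stmt-BirchSwinnertonDyer-22226`, memo
`Summits/BirchSwinnertonDyer/BirchSwinnertonDyer/Cruxes/StarredOptimalManinUnitFiveSeven/Lines/kato-lever-K3-floor-c.md`):
Kato's characterisation 1.4.2 of `inv` is a statement about `κ_∞(π) ∪ χ`.  BSD / K★ are not proved by any of this.

## References
* K. Kato, *Lectures on the approach to Iwasawa theory for Hasse–Weil L-functions via B_dR, Part I*, LNM 1553
  (1993), Ch. II 1.4.2. [Kato1993LNM1553]
* J.-P. Serre, *Galois Cohomology* (1997), Ch. II §1.2 (Kummer theory); *Local Fields* (1979), Ch. XIV §1.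
  [SerreGaloisCohomology1997] [SerreLocalFields1979]
* J. Neukirch, A. Schmidt, K. Wingberg, *Cohomology of Number Fields*, 2nd ed. (2008), (1.3.3) (naturality of
  connecting maps), II §7 Thm. 2.7.5. [NeukirchSchmidtWingberg2008]
-/

noncomputable section

open CategoryTheory Function
open Field

universe u

namespace Literature.NumberTheory.GaloisCohomology

open _root_.TopRep _root_.ContRepresentation _root_.ContinuousCohomology
open Literature.NumberTheory.GaloisRepresentations
open Literature.NumberTheory.GaloisRepresentations.DiscreteGaloisModule
open Literature.AnabelianGeometry.AbsoluteAnabelian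
open Literature.AnabelianGeometry.AbsoluteAnabelian.Prop121vii (baseUnitsInvariant baseUnitsInvariant_mul)

/-! ### The Kummer classes `κ_n(x)` and their compatibility with the power maps -/

section Level

variable (K : Type u) [Field K]

/-- **The Kummer class `κ_n(x) ∈ H¹(G_K, μ_n(K̄))`** of `x ∈ Kˣ` (`n ≥ 1`): the image of the invariant
`x ∈ (K̄ˣ)^{G_K}` (`baseUnitsInvariant`) under the connecting homomorphism `δ₀` of the Kummer sequence
`0 → μ_n → K̄ˣ →(n) K̄ˣ → 0` (`isSES_kummer`). [cite: SerreGaloisCohomology1997, II §1.2] -/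
def kummerLevel (n : ℕ) (hn : 0 < n) (x : K) (hx : x ≠ 0) : continuousCohomology 1 (mu K n).toTopRep :=
  (isSES_kummer K n hn).δ₀ (baseUnitsInvariant K x hx)

/-- `kummerLevel` only depends on the element. [cite: SerreGaloisCohomology1997, II §1.2] -/
theorem kummerLevel_congr (n : ℕ) (hn : 0 < n) {x y : K} (hx : x ≠ 0) (hy : y ≠ 0) (h : x = y) :
    kummerLevel K n hn x hx = kummerLevel K n hn y hy := by
  subst h
  rfl

/-- **`κ_n(xy) = κ_n(x) + κ_n(y)`** (`δ₀` is additive and `(xy) = (x) + (y)` in `(K̄ˣ)^{G_K}`).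
[cite: SerreGaloisCohomology1997, II §1.2] -/
theorem kummerLevel_mul (n : ℕ) (hn : 0 < n) (x y : K) (hx : x ≠ 0) (hy : y ≠ 0) :
    kummerLevel K n hn (x * y) (mul_ne_zero hx hy) = kummerLevel K n hn x hx + kummerLevel K n hn y hy := by
  rw [kummerLevel, baseUnitsInvariant_mul, map_add]
  rfl

/-- `κ_n(1) = 0`. [cite: SerreGaloisCohomology1997, II §1.2] -/
theorem kummerLevel_one (n : ℕ) (hn : 0 < n) : kummerLevel K n hn 1 one_ne_zero = 0 := by
  have h := kummerLevel_mul K n hn 1 1 one_ne_zero one_ne_zero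
  rw [kummerLevel_congr K n hn (mul_ne_zero one_ne_zero one_ne_zero) one_ne_zero (mul_one 1)] at h
  simpa using h

/-- The square `μ_N ⊆ K̄ˣ` / `μ_n ⊆ K̄ˣ` commutes with `(ζ ↦ ζ^d, u ↦ u^d)` for `n · d = N`.
[cite: NeukirchSchmidtWingberg2008, (1.3.3)] -/
theorem kummerπ_kummerι_eq {N n d : ℕ} (h : n * d = N) (v : MuCarrier K N) :
    (kummerπ K d).hom ((kummerι K N).hom v) = (kummerι K n).hom ((muPowHom K N n d h).hom v) := by
  apply unitsVal_injective K
  rw [kummerπ_hom_apply, unitsVal_zsmul, unitsVal_kummerι, unitsVal_kummerι, muPowHom_hom_apply,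
    muVal_muPow, zpow_natCast]

/-- The square `K̄ˣ →(N) K̄ˣ` / `K̄ˣ →(n) K̄ˣ` commutes with `(u ↦ u^d, id)` for `n · d = N`:
`u^N = (u^d)^n`. [cite: NeukirchSchmidtWingberg2008, (1.3.3)] -/
theorem kummerπ_kummerπ_eq {N n d : ℕ} (h : n * d = N) (u : UnitsCarrier K) :
    (𝟙 (units K).toTopRep : (units K).toTopRep ⟶ (units K).toTopRep).hom ((kummerπ K N).hom u) =
      (kummerπ K n).hom ((kummerπ K d).hom u) := by
  rw [kummerπ_hom_apply, kummerπ_hom_apply, kummerπ_hom_apply, smul_smul, ← Nat.cast_mul, h]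
  rfl

/-- **Compatibility of the Kummer classes with the power maps**: `H¹(μ_N ↠ μ_n)(κ_N(x)) = κ_n(x)` for
`n · d = N` (`ζ ↦ ζ^d`; naturality of `δ₀` for the morphism `(ζ ↦ ζ^d, u ↦ u^d, id)` of Kummer sequences).
[cite: NeukirchSchmidtWingberg2008, (1.3.3)] [cite: Kato1993LNM1553, Ch. II 1.4.2] -/
theorem cohomologyMap_muPowHom_kummerLevel {N n d : ℕ} (h : n * d = N) (hN : 0 < N) (hn : 0 < n)
    (x : K) (hx : x ≠ 0) :
    cohomologyMap (muPowHom K N n d h) 1 (kummerLevel K N hN x hx) = kummerLevel K n hn x hx := by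
  rw [kummerLevel, (isSES_kummer K N hN).cohomologyMap_δ₀ (isSES_kummer K n hn)
    (φ₁ := muPowHom K N n d h) (φ₂ := kummerπ K d) (φ₃ := 𝟙 _)
    (kummerπ_kummerι_eq K h) (kummerπ_kummerπ_eq K h) (baseUnitsInvariant K x hx), kummerLevel]
  congr 1

end Level

/-! ### The compatible family `(κ_{p^k}(x))_k` and the `p`-adic Kummer class `κ_∞(x)` -/

section Padic

variable (K : Type u) [Field K] (p : ℕ) [Fact p.Prime]

/-- `H¹(μ_{p^m} ↠ μ_{p^n})(κ_{p^m}(x)) = κ_{p^n}(x)` along the transition morphisms of `muPadicSystem`.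
[cite: NeukirchSchmidtWingberg2008, (1.3.3)] -/
theorem cohomologyMap_redHom_kummerLevel {n m : ℕ} (h : n ≤ m) (x : K) (hx : x ≠ 0) :
    cohomologyMap ((muPadicSystem K p).redHom h) 1
        (kummerLevel K (p ^ m) (pow_pos (Fact.out : p.Prime).pos m) x hx) =
      kummerLevel K (p ^ n) (pow_pos (Fact.out : p.Prime).pos n) x hx := by
  rw [muPadicSystem_redHom]
  exact cohomologyMap_muPowHom_kummerLevel K _ _ _ x hx

/-- **The compatible family `(κ_{p^k}(x))_k ∈ lim_k H¹(G_K, μ_{p^k})`** of Kummer classes of `x ∈ Kˣ`.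
[cite: Kato1993LNM1553, Ch. II 1.4.2] [cite: NeukirchSchmidtWingberg2008, II §7 Thm 2.7.5] -/
def kummerFamily (x : K) (hx : x ≠ 0) : (muPadicSystem K p).cohomologyLimit 1 :=
  ⟨fun k => kummerLevel K (p ^ k) (pow_pos (Fact.out : p.Prime).pos k) x hx,
    fun _ _ h => cohomologyMap_redHom_kummerLevel K p h x hx⟩

/-- Levels of `kummerFamily`. [cite: Kato1993LNM1553, Ch. II 1.4.2] -/
@[simp] theorem kummerFamily_coe_apply (x : K) (hx : x ≠ 0) (k : ℕ) :
    (kummerFamily K p x hx : ∀ k, continuousCohomology 1 ((muPadicSystem K p).ρ k).toTopRep) k =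
      kummerLevel K (p ^ k) (pow_pos (Fact.out : p.Prime).pos k) x hx := rfl

/-- `kummerFamily` is multiplicative. [cite: SerreGaloisCohomology1997, II §1.2] -/
theorem kummerFamily_mul (x y : K) (hx : x ≠ 0) (hy : y ≠ 0) :
    kummerFamily K p (x * y) (mul_ne_zero hx hy) = kummerFamily K p x hx + kummerFamily K p y hy :=
  Subtype.ext (funext fun k => kummerLevel_mul K (p ^ k) (pow_pos (Fact.out : p.Prime).pos k) x y hx hy)

/-- ★ **The `p`-adic Kummer class `κ_∞(x) ∈ H¹_cont(G_K, ℤ_p(1))`** of `x ∈ Kˣ` (any field `K`): the unique continuous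
class whose image under every projection `ℤ_p(1) ↠ μ_{p^k}` is the Kummer class `κ_{p^k}(x)` (through
`H¹_cont(G_K, ℤ_p(1)) ≃ lim_k H¹(G_K, μ_{p^k})`, NSW 2.7.5).  Kato II 1.4.2: "the image of `π` under
`Kˣ → H¹(K, ℚ_ℓ(1))` induced by the connecting maps of the Kummer sequences".
[cite: Kato1993LNM1553, Ch. II 1.4.2] [cite: NeukirchSchmidtWingberg2008, II §7 Thm 2.7.5] -/
def kummerPadic (x : K) (hx : x ≠ 0) : continuousCohomology 1 (tateModuleMuPadic K p).toTopRep :=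
  (continuousCohomologyOnePadicTateModuleEquiv K p).symm (kummerFamily K p x hx)

/-- The comparison isomorphism carries `κ_∞(x)` to the family `(κ_{p^k}(x))_k`. [cite: Kato1993LNM1553, Ch. II 1.4.2] -/
@[simp] theorem continuousCohomologyOnePadicTateModuleEquiv_kummerPadic (x : K) (hx : x ≠ 0) :
    continuousCohomologyOnePadicTateModuleEquiv K p (kummerPadic K p x hx) = kummerFamily K p x hx :=
  AddEquiv.apply_symm_apply _ _

/-- ★ **LEVEL FORMULA**: `H¹(ℤ_p(1) ↠ μ_{p^k})(κ_∞(x)) = κ_{p^k}(x)`. [cite: Kato1993LNM1553, Ch. II 1.4.2] -/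
theorem cohomologyMap_projHom_kummerPadic (x : K) (hx : x ≠ 0) (k : ℕ) :
    cohomologyMap ((muPadicSystem K p).projHom k) 1 (kummerPadic K p x hx) =
      kummerLevel K (p ^ k) (pow_pos (Fact.out : p.Prime).pos k) x hx := by
  change (continuousCohomologyOnePadicTateModuleEquiv K p (kummerPadic K p x hx) :
      ∀ k, continuousCohomology 1 ((muPadicSystem K p).ρ k).toTopRep) k = _
  rw [continuousCohomologyOnePadicTateModuleEquiv_kummerPadic, kummerFamily_coe_apply]

/-- **Uniqueness from the levels**: a class of `H¹_cont(G_K, ℤ_p(1))` all of whose projections are the Kummer classes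
`κ_{p^k}(x)` IS `κ_∞(x)` (injectivity of `H¹(G_K, lim) → lim H¹`, finite `μ_{p^k}`).
[cite: Kato1993LNM1553, Ch. II 1.4.2] [cite: NeukirchSchmidtWingberg2008, II §7 Thm 2.7.5] -/
theorem eq_kummerPadic_of_proj (x : K) (hx : x ≠ 0) (c : continuousCohomology 1 (tateModuleMuPadic K p).toTopRep)
    (hc : ∀ k : ℕ, cohomologyMap ((muPadicSystem K p).projHom k) 1 c =
      kummerLevel K (p ^ k) (pow_pos (Fact.out : p.Prime).pos k) x hx) :
    c = kummerPadic K p x hx := by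
  apply (continuousCohomologyOnePadicTateModuleEquiv K p).injective
  rw [continuousCohomologyOnePadicTateModuleEquiv_kummerPadic]
  exact Subtype.ext (funext fun k => hc k)

/-- `kummerPadic` only depends on the element. [cite: SerreGaloisCohomology1997, II §1.2] -/
theorem kummerPadic_congr {x y : K} (hx : x ≠ 0) (hy : y ≠ 0) (h : x = y) :
    kummerPadic K p x hx = kummerPadic K p y hy := by
  subst h
  rfl

/-- ★ **`κ_∞(xy) = κ_∞(x) + κ_∞(y)`**. [cite: SerreGaloisCohomology1997, II §1.2] -/
theorem kummerPadic_mul (x y : K) (hx : x ≠ 0) (hy : y ≠ 0) :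
    kummerPadic K p (x * y) (mul_ne_zero hx hy) = kummerPadic K p x hx + kummerPadic K p y hy := by
  apply (continuousCohomologyOnePadicTateModuleEquiv K p).injective
  rw [map_add, continuousCohomologyOnePadicTateModuleEquiv_kummerPadic,
    continuousCohomologyOnePadicTateModuleEquiv_kummerPadic,
    continuousCohomologyOnePadicTateModuleEquiv_kummerPadic, kummerFamily_mul]

/-- `κ_∞(1) = 0`. [cite: SerreGaloisCohomology1997, II §1.2] -/
theorem kummerPadic_one : kummerPadic K p 1 one_ne_zero = 0 := by
  have h := kummerPadic_mul K p 1 1 one_ne_zero one_ne_zero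
  rw [kummerPadic_congr K p (mul_ne_zero one_ne_zero one_ne_zero) one_ne_zero (mul_one 1)] at h
  simpa using h

/-- ★ **The `p`-adic Kummer map `κ_∞ : Kˣ →* H¹_cont(G_K, ℤ_p(1))`** (multiplicative to additive), `u ↦ κ_∞(u)`.
[cite: Kato1993LNM1553, Ch. II 1.4.2] [cite: SerreGaloisCohomology1997, II §1.2] -/
def kummerPadicHom : Kˣ →* Multiplicative (continuousCohomology 1 (tateModuleMuPadic K p).toTopRep) where
  toFun u := Multiplicative.ofAdd (kummerPadic K p (u : K) u.ne_zero)
  map_one' := by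
    rw [← ofAdd_zero]
    exact congrArg Multiplicative.ofAdd
      ((kummerPadic_congr K p (1 : Kˣ).ne_zero one_ne_zero Units.val_one).trans (kummerPadic_one K p))
  map_mul' u v := by
    rw [← ofAdd_add]
    exact congrArg Multiplicative.ofAdd
      ((kummerPadic_congr K p (u * v).ne_zero (mul_ne_zero u.ne_zero v.ne_zero) (Units.val_mul u v)).trans
        (kummerPadic_mul K p (u : K) (v : K) u.ne_zero v.ne_zero))

/-- `kummerPadicHom` on elements. [cite: Kato1993LNM1553, Ch. II 1.4.2] -/
@[simp] theorem toAdd_kummerPadicHom_apply (u : Kˣ) :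
    Multiplicative.toAdd (kummerPadicHom K p u) = kummerPadic K p (u : K) u.ne_zero := rfl

end Padic

end Literature.NumberTheory.GaloisCohomology

end
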